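import Mathlib.Analysis.Calculus.Deriv.Inv
import Mathlib.Analysis.Calculus.Deriv.Pow
import Mathlib.Analysis.SpecialFunctions.ExpDeriv
import Mathlib.Analysis.SpecialFunctions.Log.Basic
import Mathlib.Analysis.SpecialFunctions.Pow.Real
import Mathlib.Analysis.SpecialFunctions.Sqrt
import HarnessLib

/-!
# Barrier: linear damping does not globalise a superlinear Riccati inequality —
# `y′ ≤ −By + A y^{3/2}` admits finite-time blow-up for every `A, B > 0`

Barrier catalogue entry for `NavierStokesRegularity` (D-0021), METHOD LEVEL, everything PROVED
(pure real analysis, no named fact). Cell `ns-claims` (D-0090), technique row T1 «energy /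
`H^s`-Grönwall a-priori estimate upgraded to a global bound», variant «damped Riccati misread as
a global bound»; device row C152 `PinheiroQueiroz2025` (Zenodo 15702037, §6.3–§6.6 p. 7: from
`d/dt‖v‖²_{H^s} + 2ν‖v‖²_{H^{s+1}} ≤ C‖v‖³_{H^s}` the text sets `y = ‖v‖²_{H^s}`, writes
«`dy/dt ≤ −By + Ay^{3/2}`, where A, B > 0» (§6.4) and concludes
«`y(t) ≤ y(0)B/((B − Ay(0))e^{−Bt} + Ay(0))` … As `t → ∞`: `y(t) → B/A`» (§6.5, the locator
of record `Literature.Claims.NS.PinheiroQueiroz2025.Step4_Majorant`), «Dissipation enforces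
boundedness of the `H^s` norm for all `t ≥ 0`» (§6.6)); siblings: every `H^s` / enstrophy
scheme closing with `y′ ≤ −λy + Cy^p`, `p > 1`. Companions in the catalogue:
`SobolevOrderRaisingNoHorizonGain` (the UNDAMPED law `y′ ≤ Cy^p`: sharp finite horizon, no
horizon-free bound), `SuperlinearVolterraNoAprioriBound` (the memory form),
`EnergySupercriticality` (why the energy cannot supply the missing a-priori bound).

WHAT IS PROVED (namespace `DampedRiccati`, parameters `B A > 0`, exponent `3/2` written as
`y·√y`):

* `profile B A z₀ t = ((z₀ − A/B)e^{Bt/2} + A/B)⁻²`, the Bernoulli substitution `z = y^{−1/2}`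
  (`z′ = (B/2)z − A/2`), is an EXACT solution of `y′ = −By + A·y·√y` wherever
  `z(t) = (z₀ − A/B)e^{Bt/2} + A/B > 0` (`hasDerivAt_profile`), with `profile B A z₀ 0 = z₀⁻²`
  (`profile_zero`) — so every initial value `y₀ > 0` is realised (`z₀ = y₀^{−1/2}`);
* if `0 < z₀ < A/B`, i.e. `y₀ > (B/A)²` (above the unstable equilibrium), then `z` vanishes at
  the finite time `tstar B A z₀ = (2/B)·log((A/B)/(A/B − z₀)) > 0` (`tstar_pos`, `zfun_tstar`),
  stays positive on `[0, t*)` (`zfun_pos`), and **`y(t) → +∞` as `t → t*⁻`**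
  (`tendsto_profile_atTop`): the damped Riccati EQUATION blows up in finite time from large data;
* hence (`no_global_bound_law`) there is NO function `F` with «`y ≥ 0`, `y′ ≤ −By + A y√y` on
  `[0, T)` ⇒ `y(t) ≤ F(y(0))` for all `t < T`» valid for all horizons `T` — not even for the
  equality case — and (`not_display_65`) the printed comparison display of C152 §6.5 fails: for
  `y₀ > B/A` its right-hand side is `≤ y₀` at every `t ≥ 0` (`display65_le_init`), while the
  exact solution from `y₀ > (B/A)²` exceeds `y₀` (it is unbounded);
* the honest neighbour (`profile_le_of_small`): for `z₀ > A/B`, i.e. `y₀ < (B/A)²`, the same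
  profile is defined for all `t ≥ 0` and DEcreases (`y(t) ≤ y₀`): below the equilibrium the
  damping wins — this is the small-data regime, which is exactly what a large-data claim must go
  beyond [cite: RobinsonRodrigoSadowskiCUP2016, Lemma 6.13 and Exercise 6.2 (comparison for
  `X′ ≤ cX³`)].

## Structured block

technique_class: damped-riccati-global-bound hs-energy-gronwall-closure
  dissipation-dominates-nonlinearity steady-state-saturation-from-differential-inequality
blocks: every inference «`y′ ≤ −By + Ay^p` (`p > 1`, `A, B > 0`) for `y = ‖u‖²_X` ⇒
  `sup_{t≥0} y(t) < ∞` (or `y(t) → (B/A)^{1/(p−1)}`, or any bound uniform in `t` depending on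
  `y(0), A, B` only)» made WITHOUT a smallness hypothesis `y(0) < (B/A)^{1/(p−1)}` — adjudicated
  shape: C152 §6.4–§6.6 p.7 (exponent `3/2`); the same one-line device recurs with `p = 2, 3` in
  `H¹`/enstrophy closures [cite: RobinsonRodrigoSadowskiCUP2016, §6.2 (6.8)–(6.9) and
  Exercise 6.2].
because: above the unstable equilibrium `y* = (B/A)^{1/(p−1)}` the nonlinearity dominates the
  damping and the comparison ODE itself blows up in finite time (explicit Bernoulli profile here
  for `p = 3/2`); an upper differential inequality can never exclude what its own extremal
  solution does [cite: RobinsonRodrigoSadowskiCUP2016, Exercise 6.2].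
evasions_known: (1) SMALL DATA `y(0) < y*` (then `y` is non-increasing and global —
  `profile_le_of_small`; this is RRS Lemma 6.13 / Thm 6.12 in the `H¹` setting, tree
  `TorusNSSmallDataGlobal`, `LerayEnstrophyMonotone.exists_enstrophy_le_initial_of_small`);
  (2) an ADDITIONAL a-priori bound on a critical/subcritical quantity entering `A` (e.g.
  `∫₀^∞ ‖∇u‖_∞ < ∞`, BKM) turns the law linear; (3) keeping the dissipation `2ν‖v‖²_{H^{s+1}}`
  and interpolating (`‖v‖_{H^s}^{…} ≤ ‖v‖_{L²}^{…}‖v‖_{H^{s+1}}^{…}`) changes the exponent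
  bookkeeping but reproduces the same supercritical gap [cite: RobinsonRodrigoSadowskiCUP2016,
  §6.2].
scope_caveats: pure ODE statement about real functions; it refutes the INFERENCE from the
  differential inequality, not any property of Navier–Stokes solutions (whose `H^s` norms may or
  may not blow up — that is the open problem); exponent fixed to `3/2` in the kernel (the printed
  one), the structured text covers `p > 1`.
status: established; every conjunct proved below (`dampedRiccatiNoGlobalBound_holds`, standard
  axioms).

## References

* J. C. Robinson, J. L. Rodrigo, W. Sadowski, *The Three-Dimensional Navier–Stokes Equations*,
  CUP 2016, §6.2 (comparison principle for `X′ ≤ cX³`, (6.8)–(6.9)), Lemma 6.13, Exercise 6.2.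
  [RobinsonRodrigoSadowskiCUP2016]

WHAT THIS IS NOT: not a claim about NS regularity or blow-up; not a claim about any author beyond
the typed locator.
-/

noncomputable section

open Real Set Filter Topology

namespace Literature.Barriers.NavierStokesRegularity.DampedRiccati

/-- The Bernoulli variable `z(t) = (z₀ − A/B) e^{Bt/2} + A/B` (`z = y^{−1/2}` linearises
`y′ = −By + Ay^{3/2}` into `z′ = (B/2) z − A/2`).
[cite: RobinsonRodrigoSadowskiCUP2016, Exercise 6.2] -/
def zfun (B A z₀ t : ℝ) : ℝ := (z₀ - A / B) * exp (B * t / 2) + A / B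

/-- The exact profile `y(t) = z(t)⁻²`. [cite: RobinsonRodrigoSadowskiCUP2016, Exercise 6.2] -/
def profile (B A z₀ t : ℝ) : ℝ := (zfun B A z₀ t)⁻¹ ^ 2

/-- The blow-up time `t* = (2/B) log((A/B)/(A/B − z₀))` (where `z(t*) = 0`), for `0 < z₀ < A/B`.
[cite: RobinsonRodrigoSadowskiCUP2016, Exercise 6.2] -/
def tstar (B A z₀ : ℝ) : ℝ := 2 / B * log ((A / B) / (A / B - z₀))

variable {B A z₀ : ℝ}

/-- `z(0) = z₀`. [cite: RobinsonRodrigoSadowskiCUP2016, Exercise 6.2] -/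
theorem zfun_zero (B A z₀ : ℝ) : zfun B A z₀ 0 = z₀ := by
  simp [zfun]

/-- `y(0) = z₀⁻²` (every `y₀ > 0` is `z₀⁻²` with `z₀ = y₀^{−1/2}`).
[cite: RobinsonRodrigoSadowskiCUP2016, Exercise 6.2] -/
theorem profile_zero (B A z₀ : ℝ) : profile B A z₀ 0 = z₀⁻¹ ^ 2 := by
  simp [profile, zfun_zero]

/-- `z′(t) = (B/2)(z₀ − A/B)e^{Bt/2}`. [cite: RobinsonRodrigoSadowskiCUP2016, Exercise 6.2] -/
theorem hasDerivAt_zfun (B A z₀ t : ℝ) :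
    HasDerivAt (zfun B A z₀) ((z₀ - A / B) * (exp (B * t / 2) * (B / 2))) t := by
  have h1 : HasDerivAt (fun s : ℝ => B * s / 2) (B / 2) t := by
    have := ((hasDerivAt_id t).const_mul B).div_const 2
    simpa using this
  have h2 := (h1.exp).const_mul (z₀ - A / B)
  have h3 := h2.add_const (A / B)
  exact h3

/-- **The profile solves the damped Riccati equation** `y′ = −B y + A y √y` wherever `z(t) > 0`.
[cite: RobinsonRodrigoSadowskiCUP2016, Exercise 6.2] -/
theorem hasDerivAt_profile (hB : B ≠ 0) {t : ℝ} (hz : 0 < zfun B A z₀ t) :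
    HasDerivAt (profile B A z₀)
      (-B * profile B A z₀ t + A * profile B A z₀ t * sqrt (profile B A z₀ t)) t := by
  have hz' := hasDerivAt_zfun B A z₀ t
  -- derivative of `z ↦ z⁻¹ ^ 2 = (z ^ 2)⁻¹`
  have hinv0 := (hz'.fun_inv hz.ne').fun_pow 2
  have hinv : HasDerivAt (fun s => (zfun B A z₀ s)⁻¹ ^ 2)
      (2 * (zfun B A z₀ t)⁻¹ *
        (-((z₀ - A / B) * (exp (B * t / 2) * (B / 2))) / (zfun B A z₀ t) ^ 2)) t := by
    refine hinv0.congr_deriv ?_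
    norm_num
  have hsqrt : sqrt (profile B A z₀ t) = (zfun B A z₀ t)⁻¹ := by
    rw [profile, sqrt_sq (inv_nonneg.2 hz.le)]
  refine hinv.congr_deriv ?_
  rw [hsqrt, profile]
  have hz0 : zfun B A z₀ t ≠ 0 := hz.ne'
  -- write `A = B (z − c e^{Bt/2})`, `c = z₀ − A/B`, and compare
  set Z : ℝ := zfun B A z₀ t with hZ
  set c : ℝ := z₀ - A / B with hc
  have hA' : A = B * (Z - c * exp (B * t / 2)) := by
    rw [hZ, zfun, ← hc]
    field_simp
    ring
  rw [hA']
  field_simp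
  ring

/-- For `0 < z₀ < A/B` the blow-up time is positive. [cite: RobinsonRodrigoSadowskiCUP2016, Exercise
6.2] -/
theorem tstar_pos (hB : 0 < B) (hA : 0 < A) (hz₀ : 0 < z₀) (hzA : z₀ < A / B) :
    0 < tstar B A z₀ := by
  have hAB : 0 < A / B := div_pos hA hB
  have hden : 0 < A / B - z₀ := sub_pos.2 hzA
  have hgt : 1 < (A / B) / (A / B - z₀) := by
    rw [lt_div_iff₀ hden]; linarith
  exact mul_pos (div_pos two_pos hB) (log_pos hgt)

/-- `z(t*) = 0`. [cite: RobinsonRodrigoSadowskiCUP2016, Exercise 6.2] -/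
theorem zfun_tstar (hB : 0 < B) (hA : 0 < A) (hzA : z₀ < A / B) :
    zfun B A z₀ (tstar B A z₀) = 0 := by
  have hAB : 0 < A / B := div_pos hA hB
  have hden : 0 < A / B - z₀ := sub_pos.2 hzA
  have hexp : exp (B * tstar B A z₀ / 2) = (A / B) / (A / B - z₀) := by
    rw [tstar, show B * (2 / B * log (A / B / (A / B - z₀))) / 2 = log (A / B / (A / B - z₀)) by
      field_simp]
    exact exp_log (div_pos hAB hden)
  have hne : A - z₀ * B ≠ 0 := by
    have : z₀ * B < A := by rwa [lt_div_iff₀ hB] at hzA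
    linarith
  rw [zfun, hexp]
  field_simp
  ring

/-- `z > 0` on `[0, t*)` (for `0 < z₀ < A/B`): `z` is strictly decreasing and vanishes at `t*`.
[cite: RobinsonRodrigoSadowskiCUP2016, Exercise 6.2] -/
theorem zfun_pos (hB : 0 < B) (hA : 0 < A) (hzA : z₀ < A / B) {t : ℝ}
    (ht : t < tstar B A z₀) : 0 < zfun B A z₀ t := by
  have hneg : z₀ - A / B < 0 := by linarith
  have hmono : exp (B * t / 2) < exp (B * tstar B A z₀ / 2) :=
    exp_lt_exp.2 (by nlinarith)
  have h0 := zfun_tstar hB hA hzA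
  rw [zfun] at h0 ⊢
  nlinarith [hmono, hneg]

/-- `z(t) → 0⁺` as `t → t*⁻`. [cite: RobinsonRodrigoSadowskiCUP2016, Exercise 6.2] -/
theorem tendsto_zfun_nhdsLT (hB : 0 < B) (hA : 0 < A) (hzA : z₀ < A / B) :
    Tendsto (zfun B A z₀) (𝓝[<] tstar B A z₀) (𝓝[>] 0) := by
  have hcont : Continuous (zfun B A z₀) := by
    unfold zfun; fun_prop
  have h1 : Tendsto (zfun B A z₀) (𝓝[<] tstar B A z₀) (𝓝 0) := by
    rw [← zfun_tstar hB hA hzA]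
    exact (hcont.tendsto _).mono_left nhdsWithin_le_nhds
  refine tendsto_nhdsWithin_iff.2 ⟨h1, ?_⟩
  filter_upwards [self_mem_nhdsWithin] with t ht
  exact zfun_pos hB hA hzA ht

/-- **Finite-time blow-up of the damped Riccati equation from large data**: for `0 < z₀ < A/B`
(`y₀ = z₀⁻² > (B/A)²`) the exact solution `y = profile B A z₀` of `y′ = −By + A y√y` tends to `+∞`
as `t → t*⁻`. [cite: RobinsonRodrigoSadowskiCUP2016, Exercise 6.2] -/
theorem tendsto_profile_atTop (hB : 0 < B) (hA : 0 < A) (hzA : z₀ < A / B) :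
    Tendsto (profile B A z₀) (𝓝[<] tstar B A z₀) atTop := by
  have h1 : Tendsto (fun t => (zfun B A z₀ t)⁻¹) (𝓝[<] tstar B A z₀) atTop :=
    tendsto_inv_nhdsGT_zero.comp (tendsto_zfun_nhdsLT hB hA hzA)
  have h2 := h1.atTop_mul_atTop₀ h1
  refine h2.congr fun t => ?_
  simp [profile, sq]

/-- The profile is unbounded on `[0, t*)`. [cite: RobinsonRodrigoSadowskiCUP2016, Exercise 6.2] -/
theorem not_bddAbove_profile (hB : 0 < B) (hA : 0 < A) (hz₀ : 0 < z₀) (hzA : z₀ < A / B) (M : ℝ) :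
    ∃ t ∈ Ico 0 (tstar B A z₀), M < profile B A z₀ t := by
  have hev : ∀ᶠ t in 𝓝[<] tstar B A z₀, M < profile B A z₀ t :=
    (tendsto_profile_atTop hB hA hzA).eventually (eventually_gt_atTop M)
  have hev' : ∀ᶠ t in 𝓝[<] tstar B A z₀, t ∈ Ico 0 (tstar B A z₀) := by
    filter_upwards [Ioo_mem_nhdsLT (tstar_pos hB hA hz₀ hzA)] with t ht
    exact ⟨ht.1.le, ht.2⟩
  obtain ⟨t, h1, h2⟩ := (hev'.and hev).exists
  exact ⟨t, h1, h2⟩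

/-- **No global-bound law.** There is no `F : ℝ → ℝ → ℝ → ℝ` such that, for all `B, A > 0`, every
`T > 0` and every `y` differentiable on `[0, T)` with `y ≥ 0` and `y′ ≤ −By + A y√y` there,
`y(t) ≤ F(y(0), A, B)` for all `t ∈ [0, T)` — the exact blow-up profile violates it just before
`t*`.
[cite: RobinsonRodrigoSadowskiCUP2016, Exercise 6.2] -/
theorem no_global_bound_law :
    ¬ ∃ F : ℝ → ℝ → ℝ → ℝ, ∀ B A : ℝ, 0 < B → 0 < A → ∀ (T : ℝ) (y : ℝ → ℝ),
        (∀ t ∈ Ico 0 T, 0 ≤ y t) →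
        (∀ t ∈ Ico 0 T, ∃ y' : ℝ, HasDerivAt y y' t ∧ y' ≤ -B * y t + A * y t * sqrt (y t)) →
        ∀ t ∈ Ico 0 T, y t ≤ F (y 0) A B := by
  rintro ⟨F, hF⟩
  -- `B = A = 1`, `z₀ = 1/2 < A/B = 1`
  have hB : (0 : ℝ) < 1 := one_pos
  have hz₀ : (0 : ℝ) < 1 / 2 := by norm_num
  have hzA : (1 / 2 : ℝ) < 1 / 1 := by norm_num
  set T := tstar 1 1 (1 / 2) with hT
  have h := hF 1 1 hB hB T (profile 1 1 (1 / 2))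
    (fun t _ => sq_nonneg _)
    (fun t ht => ⟨_, hasDerivAt_profile one_ne_zero (zfun_pos hB hB hzA ht.2), le_rfl⟩)
  obtain ⟨t, ht, hgt⟩ := not_bddAbove_profile hB hB hz₀ hzA (F (profile 1 1 (1 / 2) 0) 1 1)
  exact absurd (h t ht) (not_le.2 hgt)

/-- The right-hand side of the printed comparison display (C152 §6.5 p.7)
`y(0)·B / ((B − A·y(0))e^{−Bt} + A·y(0))` is at most `y(0)` for `t ≥ 0` whenever `y(0) ≥ B/A`
(its denominator is then `≥ B`). [cite: RobinsonRodrigoSadowskiCUP2016, Exercise 6.2] -/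
theorem display65_le_init {B A y₀ t : ℝ} (hB : 0 < B) (hA : 0 < A) (hy : B / A ≤ y₀) (ht : 0 ≤ t) :
    y₀ * B / ((B - A * y₀) * exp (-(B * t)) + A * y₀) ≤ y₀ := by
  have hy0 : 0 < y₀ := lt_of_lt_of_le (div_pos hB hA) hy
  have hAy : B ≤ A * y₀ := by rwa [div_le_iff₀ hA, mul_comm] at hy
  have hexp1 : exp (-(B * t)) ≤ 1 := exp_le_one_iff.2 (by nlinarith)
  have hexp0 : 0 < exp (-(B * t)) := exp_pos _
  have hden : B ≤ (B - A * y₀) * exp (-(B * t)) + A * y₀ := by nlinarith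
  have hdenpos : 0 < (B - A * y₀) * exp (-(B * t)) + A * y₀ := hB.trans_le hden
  rw [div_le_iff₀ hdenpos]
  nlinarith

/-- **The printed comparison display fails**: it is false that every solution of
`y′ = −By + A y√y` on `[0, T)` with `y ≥ 0` obeys `y(t) ≤ y(0)B/((B − Ay(0))e^{−Bt} + Ay(0))`
(C152 §6.5 p.7) — the large-data profile exceeds `y(0) ≥` that bound.
[cite: RobinsonRodrigoSadowskiCUP2016, Exercise 6.2] -/
theorem not_display_65 :
    ¬ ∀ B A : ℝ, 0 < B → 0 < A → ∀ (T : ℝ) (y : ℝ → ℝ), (∀ t ∈ Ico 0 T, 0 ≤ y t) →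
        (∀ t ∈ Ico 0 T, HasDerivAt y (-B * y t + A * y t * sqrt (y t)) t) →
        ∀ t ∈ Ico 0 T, y t ≤ y 0 * B / ((B - A * y 0) * exp (-(B * t)) + A * y 0) := by
  intro h
  have hB : (0 : ℝ) < 1 := one_pos
  have hz₀ : (0 : ℝ) < 1 / 2 := by norm_num
  have hzA : (1 / 2 : ℝ) < 1 / 1 := by norm_num
  set T := tstar 1 1 (1 / 2) with hT
  have h1 := h 1 1 hB hB T (profile 1 1 (1 / 2)) (fun t _ => sq_nonneg _)
    (fun t ht => hasDerivAt_profile one_ne_zero (zfun_pos hB hB hzA ht.2))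
  have hy0 : profile 1 1 (1 / 2) 0 = 4 := by rw [profile_zero]; norm_num
  obtain ⟨t, ht, hgt⟩ := not_bddAbove_profile hB hB hz₀ hzA 4
  have h2 := h1 t ht
  rw [hy0] at h2
  have h3 : (4 : ℝ) * 1 / ((1 - 1 * 4) * exp (-(1 * t)) + 1 * 4) ≤ 4 :=
    display65_le_init hB hB (by norm_num) ht.1
  linarith

/-- **Honest neighbour — the small-data regime**: for `z₀ > A/B` (`y₀ < (B/A)²`) the profile is
defined for all `t ≥ 0`, solves the equation, and is non-increasing: `y(t) ≤ y(0)`.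
[cite: RobinsonRodrigoSadowskiCUP2016, Lemma 6.13] -/
theorem profile_le_of_small (hB : 0 < B) (hA : 0 < A) (hzA : A / B < z₀) {t : ℝ} (ht : 0 ≤ t) :
    0 < zfun B A z₀ t ∧ profile B A z₀ t ≤ profile B A z₀ 0 := by
  have hAB : A / B < z₀ := hzA
  have hexp : 1 ≤ exp (B * t / 2) := one_le_exp_iff.2 (by positivity)
  have hz0 : 0 < z₀ := (div_pos hA hB).trans hAB
  have hge : z₀ ≤ zfun B A z₀ t := by
    rw [zfun]; nlinarith [sub_pos.2 hAB]
  have hzt : 0 < zfun B A z₀ t := hz0.trans_le hge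
  refine ⟨hzt, ?_⟩
  rw [profile, profile_zero]
  have : (zfun B A z₀ t)⁻¹ ≤ z₀⁻¹ := inv_anti₀ hz0 hge
  exact pow_le_pow_left₀ (inv_nonneg.2 hzt.le) this 2

end DampedRiccati

open DampedRiccati

/-- **BARRIER `DampedRiccatiNoGlobalBound` — «linear damping does not globalise a superlinear
Riccati inequality».** Conjunction of: (i) for all `B, A > 0` and `0 < z₀ < A/B`, the exact solution
`profile B A z₀` of `y′ = −By + A y√y` on `[0, t*)` (`t* > 0`) tends to `+∞` at `t*⁻`; (ii) no
global-bound law `y(t) ≤ F(y(0), A, B)` follows from `y ≥ 0 ∧ y′ ≤ −By + Ay√y`; (iii) the printed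
comparison display of C152 §6.5 fails; (iv) below the equilibrium (`z₀ > A/B`) the profile decays.
See the module docstring for the structured block. [cite: RobinsonRodrigoSadowskiCUP2016, §6.2
(6.8)–(6.9), Lemma 6.13, Exercise 6.2] -/
def DampedRiccatiNoGlobalBound : Prop :=
  (∀ B A z₀ : ℝ, 0 < B → 0 < A → 0 < z₀ → z₀ < A / B →
      0 < tstar B A z₀ ∧
        (∀ t, t < tstar B A z₀ → HasDerivAt (profile B A z₀)
          (-B * profile B A z₀ t + A * profile B A z₀ t * sqrt (profile B A z₀ t)) t) ∧
        Tendsto (profile B A z₀) (𝓝[<] tstar B A z₀) atTop) ∧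
  (¬ ∃ F : ℝ → ℝ → ℝ → ℝ, ∀ B A : ℝ, 0 < B → 0 < A → ∀ (T : ℝ) (y : ℝ → ℝ),
      (∀ t ∈ Ico 0 T, 0 ≤ y t) →
      (∀ t ∈ Ico 0 T, ∃ y' : ℝ, HasDerivAt y y' t ∧ y' ≤ -B * y t + A * y t * sqrt (y t)) →
      ∀ t ∈ Ico 0 T, y t ≤ F (y 0) A B) ∧
  (¬ ∀ B A : ℝ, 0 < B → 0 < A → ∀ (T : ℝ) (y : ℝ → ℝ), (∀ t ∈ Ico 0 T, 0 ≤ y t) →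
      (∀ t ∈ Ico 0 T, HasDerivAt y (-B * y t + A * y t * sqrt (y t)) t) →
      ∀ t ∈ Ico 0 T, y t ≤ y 0 * B / ((B - A * y 0) * exp (-(B * t)) + A * y 0)) ∧
  (∀ B A z₀ : ℝ, 0 < B → 0 < A → A / B < z₀ → ∀ t, 0 ≤ t →
      0 < zfun B A z₀ t ∧ profile B A z₀ t ≤ profile B A z₀ 0)

/-- **Discharge**: every conjunct of `DampedRiccatiNoGlobalBound` is a theorem of this file.
[cite: RobinsonRodrigoSadowskiCUP2016, §6.2 and Exercise 6.2] -/
theorem dampedRiccatiNoGlobalBound_holds : DampedRiccatiNoGlobalBound :=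
  ⟨fun _ _ _ hB hA hz₀ hzA => ⟨tstar_pos hB hA hz₀ hzA,
      fun _ ht => hasDerivAt_profile hB.ne' (zfun_pos hB hA hzA ht),
      tendsto_profile_atTop hB hA hzA⟩,
    no_global_bound_law, not_display_65,
    fun _ _ _ hB hA hzA _ ht => profile_le_of_small hB hA hzA ht⟩

end Literature.Barriers.NavierStokesRegularity
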